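import Summits.Ventures.CertifiedQuantumChemistry.Rows.StrongCouplingEntryBounds
import Summits.Ventures.CertifiedQuantumChemistry.Rows.HubbardRingTVDoublonBound
import HarnessLib

/-!
# Ventures/CertifiedQuantumChemistry — Rows/StrongCouplingBudgetBounds.lean: CLAIM N step (1)
# COMPLETED ON THE PROGRAMME — the doublon budget `Σ_p Re d_p ≤ S` controls every entry class the
# words name; with the energy hypothesis `S = (4τ|Λ|√|Λ|/U)²`; the TV-H optimal pair unconditionally

HONEST FRAMING (verbatim): certified bounds for a stated model Hamiltonian in a stated basis; not a
claim about the real molecule beyond that model. Nothing here is a state, a row, a claim node or a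
value of record; the statements are about ARBITRARY (resp. optimal) feasible pairs of the abstract
`D, Q, G` programme with sector rows (`IsDQGFeasibleSector`) of a Hubbard-type integral table, the
cell's test-vector tables `hubbardRingTV L t U` included (§5).

Seat rdm-B (gen 36), zero compute; theorems only (no `def`). Sibling of
`Rows/StrongCouplingEntryBounds.lean` (same gen: the MECHANISMS — `D`/`Q`/`G` border and corner entries
against small diagonals, the connected-`G` charge identity `w_p†Ĝw_p = d_p + e_p − (n_p − 1)²` and its
Cauchy–Schwarz consequences) and of `Rows/StrongCouplingDoublonBound.lean` /
`Rows/HubbardRingTVDoublonBound.lean` (gen 35: the BUDGET `Σ_p Re d_p ≤ (4τ|Λ|√|Λ|/U)²` from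
`Re E ≤ Re E_core`, `U > 0`). CLAIM N (HOME/INBOX L765 (ii); `STRUCTURE.md` §2.2.13 (ii)) step (1):
"`Σ_i d_i ≤ C²ε²` — EVERY scaled variable is bounded along the sequence (`Δ_ii, Ε_ii ≤ C²`, hops
`/ε ≤ 2C`; … every border entry `/ε` … every `J–J′` entry `/ε²`; … `u_i` and `κ_{ii′}`)". Here the list
is CLOSED on the programme (`d_p := Γ_{(p↑,p↓),(p↑,p↓)}`, `e_p := ²Q_{(p↑,p↓),(p↑,p↓)}`,
`n_p := γ_{p↑,p↑} + γ_{p↓,p↓}`, `w_p := e_(p↑,p↑) + e_(p↓,p↓)`, `Ĝ := gMap γ Γ − γγ†`, `ε = 1/U`,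
`S = C²ε²`):

* §4 THE BUDGET CONTROLS EVERY CLASS. For a feasible pair of the sector programme at HALF FILLING
  `a + b = |Λ|` and ANY `S` with `Σ_p Re d_p ≤ S`: `Re d_p ≤ S` and `Re e_p ≤ S` (the words' `Δ_ii`,
  `Ε_ii`; `Σ e = Σ d`), `‖γ_{pσ,qσ}‖ ≤ 2√S` for `p ≠ q` (hops `/ε ≤ 2C`; `|Λ| ≥ 2`),
  `‖Γ_{r,(p↑,p↓)}‖, ‖Γ_{(p↑,p↓),r}‖, ‖²Q_{r,(p↑,p↓)}‖, ‖²Q_{(p↑,p↓),r}‖ ≤ √S` for EVERY pair index `r`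
  (border entries `/ε` — adjacent AND non-adjacent two-site rows alike, caveat (vi)'s pair-splitting
  entries included), `‖Γ_{(p↑,p↓),(q↑,q↓)}‖, ‖²Q_{(p↑,p↓),(q↑,q↓)}‖ ≤ S` (`J–J′` entries `/ε²`),
  `Re w_p†Ĝw_p ≤ 2S`, `‖w_p†Ĝw_q‖ ≤ 2S` (`u_i`, `κ_{ii′}`), `(Re n_p − 1)² ≤ 2S` (local half filling).
* §5 WITH THE ENERGY HYPOTHESIS. For a Hubbard-type table (`h_pp = 0`, `‖h_pq‖ ≤ τ`,
  `(pq|rs) = U·[p = q = r = s]`, `U > 0`, scalar `E_core`) and `Re E(γ, Γ) ≤ Re E_core` the budget is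
  `S = (4τ|Λ|√|Λ|/U)²` (`StrongCouplingDoublon.sum_doublon_le_sq`): `norm_hop_le_of_energy_le`
  (`‖γ_{pσ,qσ}‖ ≤ 8τ|Λ|√|Λ|/U`), `sq_occupation_sub_one_le_of_energy_le`; and for the TV-H files
  `hubbardRingTV L t U` at half filling `a + b = L ≥ 2`, `U > 0`, the WHOLE LIST holds with
  `√S = 4|t|L√L/U` for an OPTIMAL pair, UNCONDITIONALLY (`hubbardRingTV_optimal_entry_bounds`; the
  value is `≤ 0` by `hubbardRingTV_pqgSectorEnergy_le_zero`).

What this file is NOT: the identification of these finite-`U` entries with the NAMED variables of the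
emitted limit programme `X_∞¹FS(L, X)` (a definition item nobody has filed); steps (2)–(4) are typed
abstractly in `Rows/ClaimNAnalyticStep.lean`. Everything is PROVED (0 sorry), standard axioms; no
definitions, no named facts; no claim node, hint, row or CERTIFIED cell depends on it. References
(docstring-only): as in the siblings (Mazziotti 2007 ch. 3 §II.B; Horn–Johnson §7.1; Verstichel et
al. 2012).
-/

noncomputable section

namespace Summit.Ventures.CertifiedQuantumChemistry

open Matrix Finset
open Literature.MathematicalPhysics.QuantumLattice Literature.MathematicalPhysics.QuantumChemistry
open scoped ComplexOrder

namespace StrongCouplingEntry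

/-! ### §4 The budget controls every entry class -/

section Budget

variable {Λ : Type*} [LinearOrder Λ] [Fintype Λ] {N a b : ℕ} {S : ℝ}
variable {γ : Matrix (Orb Λ) (Orb Λ) ℂ} {Γ : Matrix (Orb Λ × Orb Λ) (Orb Λ × Orb Λ) ℂ}

omit [LinearOrder Λ] [Fintype Λ] in
/-- Both same-site doublon entries of an antisymmetric `Γ` are `d_p`:
`Γ_{(pσ,pτ),(pσ,pτ)} = Γ_{(p↑,p↓),(p↑,p↓)}` for `σ ≠ τ`. (plumbing) [folklore] -/
theorem two_apply_sameSite_eq_doublon (hfst : ∀ i j q, Γ (j, i) q = -Γ (i, j) q)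
    (hsnd : ∀ r k l, Γ r (l, k) = -Γ r (k, l)) (p : Λ) {σ τ : Fin 2} (hστ : σ ≠ τ) :
    Γ (orb p σ, orb p τ) (orb p σ, orb p τ) = Γ (orb p 0, orb p 1) (orb p 0, orb p 1) := by
  fin_cases σ <;> fin_cases τ
  · exact absurd rfl hστ
  · rfl
  · exact StrongCouplingDoublon.two_apply_swap_sameSite hfst hsnd p 0 1
  · exact absurd rfl hστ

omit [Fintype Λ] in
/-- Both same-site holon entries are `e_p`: `²Q_{(pσ,pτ),(pσ,pτ)} = ²Q_{(p↑,p↓),(p↑,p↓)}` for `σ ≠ τ`.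
(plumbing) [folklore] -/
theorem qMap_apply_sameSite_eq_holon (hfst : ∀ i j q, Γ (j, i) q = -Γ (i, j) q)
    (hsnd : ∀ r k l, Γ r (l, k) = -Γ r (k, l)) (p : Λ) {σ τ : Fin 2} (hστ : σ ≠ τ) :
    qMap γ Γ (orb p σ, orb p τ) (orb p σ, orb p τ) =
      qMap γ Γ (orb p 0, orb p 1) (orb p 0, orb p 1) := by
  fin_cases σ <;> fin_cases τ
  · exact absurd rfl hστ
  · rfl
  · exact StrongCouplingDoublon.qMap_apply_swap_sameSite hfst hsnd p (show (0 : Fin 2) ≠ 1 by decide)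
  · exact absurd rfl hστ

/-- **`Re d_p ≤ S`** (the words' `Δ_ii ≤ C²`): each doublon weight is below the budget (non-negative
summands). [folklore] -/
theorem doublon_re_le (hf : IsDQGFeasible N γ Γ)
    (hs : ∑ p : Λ, (Γ (orb p 0, orb p 1) (orb p 0, orb p 1)).re ≤ S) (p : Λ) :
    (Γ (orb p 0, orb p 1) (orb p 0, orb p 1)).re ≤ S :=
  (Finset.single_le_sum (f := fun q : Λ => (Γ (orb q 0, orb q 1) (orb q 0, orb q 1)).re)
    (fun q _ => (Complex.nonneg_iff.1 (hf.d_psd.diag_nonneg (i := (orb q 0, orb q 1)))).1)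
    (Finset.mem_univ p)).trans hs

/-- The budget is non-negative. (plumbing) [folklore] -/
theorem budget_nonneg [Nonempty Λ] (hf : IsDQGFeasible N γ Γ)
    (hs : ∑ p : Λ, (Γ (orb p 0, orb p 1) (orb p 0, orb p 1)).re ≤ S) : 0 ≤ S :=
  (Complex.nonneg_iff.1 (hf.d_psd.diag_nonneg
    (i := (orb (Classical.arbitrary Λ) 0, orb (Classical.arbitrary Λ) 1)))).1.trans
    (doublon_re_le hf hs _)

/-- **`Re e_p ≤ S`** at half filling (the words' `Ε_ii ≤ C²`): each holon weight is below the
doublon budget, since `Σ_p e_p = Σ_p d_p` on the half-filled sector programme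
(`sum_holon_eq_sum_doublon`). [folklore] -/
theorem holon_re_le (hf : IsDQGFeasibleSector a b γ Γ) (hN : a + b = Fintype.card Λ)
    (hs : ∑ p : Λ, (Γ (orb p 0, orb p 1) (orb p 0, orb p 1)).re ≤ S) (p : Λ) :
    (qMap γ Γ (orb p 0, orb p 1) (orb p 0, orb p 1)).re ≤ S := by
  have hed : ∑ q : Λ, (qMap γ Γ (orb q 0, orb q 1) (orb q 0, orb q 1)).re
      = ∑ q : Λ, (Γ (orb q 0, orb q 1) (orb q 0, orb q 1)).re := by
    have hc := congrArg Complex.re (sum_holon_eq_sum_doublon γ Γ hf hN)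
    rwa [Complex.re_sum, Complex.re_sum] at hc
  refine le_trans ?_ (hed.le.trans hs)
  exact Finset.single_le_sum (f := fun q : Λ => (qMap γ Γ (orb q 0, orb q 1) (orb q 0, orb q 1)).re)
    (fun q _ => (Complex.nonneg_iff.1 (hf.dqg.q_psd.diag_nonneg (i := (orb q 0, orb q 1)))).1)
    (Finset.mem_univ p)

/-- **HOPS ARE `O(ε)`** (the words' hops `/ε ≤ 2C`): at half filling `a + b = |Λ| ≥ 2`, for sites
`p ≠ q` and each spin, `‖γ_{pσ,qσ}‖ ≤ 2√S` — the bookkeeping file's hop bound `≤ √d_p + √e_p` and the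
two weight bounds. [folklore] -/
theorem norm_hop_le (hf : IsDQGFeasibleSector a b γ Γ) (hN : a + b = Fintype.card Λ)
    (hΛ : 2 ≤ Fintype.card Λ)
    (hs : ∑ p : Λ, (Γ (orb p 0, orb p 1) (orb p 0, orb p 1)).re ≤ S) {p q : Λ} (hpq : p ≠ q)
    (σ : Fin 2) : ‖γ (orb p σ) (orb q σ)‖ ≤ 2 * Real.sqrt S := by
  obtain ⟨τ, hστ⟩ : ∃ τ : Fin 2, σ ≠ τ := ⟨σ + 1, by fin_cases σ <;> decide⟩
  have hr : a + b + 2 ≤ Fintype.card (Orb Λ) := by rw [StrongCouplingDoublon.card_orb]; omega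
  have h := norm_one_hop_le_sqrt_add_sqrt hf.dqg hr hστ hpq
  rw [two_apply_sameSite_eq_doublon hf.dqg.swap_fst hf.dqg.swap_snd p hστ,
    qMap_apply_sameSite_eq_holon hf.dqg.swap_fst hf.dqg.swap_snd p hστ] at h
  have h1 := Real.sqrt_le_sqrt (doublon_re_le hf.dqg hs p)
  have h2 := Real.sqrt_le_sqrt (holon_re_le hf hN hs p)
  linarith

/-- **`D`-BORDER ENTRIES ARE `O(ε)`**: `‖Γ_{r,(p↑,p↓)}‖ ≤ √S` for EVERY pair index `r` — adjacent and
non-adjacent two-site rows alike (caveat (vi)'s pair-splitting entries included). [folklore] -/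
theorem norm_two_apply_doublon_le (hf : IsDQGFeasible N γ Γ)
    (hs : ∑ p : Λ, (Γ (orb p 0, orb p 1) (orb p 0, orb p 1)).re ≤ S) (r : Orb Λ × Orb Λ) (p : Λ) :
    ‖Γ r (orb p 0, orb p 1)‖ ≤ Real.sqrt S :=
  (norm_two_apply_le_sqrt_diag hf r _).trans (Real.sqrt_le_sqrt (doublon_re_le hf hs p))

/-- The same for the transposed entry `‖Γ_{(p↑,p↓),r}‖ ≤ √S` (`Γ` is Hermitian). [folklore] -/
theorem norm_two_doublon_apply_le (hf : IsDQGFeasible N γ Γ)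
    (hs : ∑ p : Λ, (Γ (orb p 0, orb p 1) (orb p 0, orb p 1)).re ≤ S) (p : Λ) (r : Orb Λ × Orb Λ) :
    ‖Γ (orb p 0, orb p 1) r‖ ≤ Real.sqrt S := by
  rw [← hf.d_psd.isHermitian.apply (orb p 0, orb p 1) r, norm_star]
  exact norm_two_apply_doublon_le hf hs r p

/-- **`D`-CORNER ENTRIES ARE `O(ε²)`**: `‖Γ_{(p↑,p↓),(q↑,q↓)}‖ ≤ S`. [folklore] -/
theorem norm_two_apply_doublon_doublon_le (hf : IsDQGFeasible N γ Γ)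
    (hs : ∑ p : Λ, (Γ (orb p 0, orb p 1) (orb p 0, orb p 1)).re ≤ S) (p q : Λ) :
    ‖Γ (orb p 0, orb p 1) (orb q 0, orb q 1)‖ ≤ S := by
  have hS : 0 ≤ S := by haveI : Nonempty Λ := ⟨p⟩; exact budget_nonneg hf hs
  refine (norm_two_apply_le_sqrt_mul_sqrt hf _ _).trans ?_
  calc Real.sqrt (Γ (orb p 0, orb p 1) (orb p 0, orb p 1)).re *
        Real.sqrt (Γ (orb q 0, orb q 1) (orb q 0, orb q 1)).re
      ≤ Real.sqrt S * Real.sqrt S :=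
        mul_le_mul (Real.sqrt_le_sqrt (doublon_re_le hf hs p))
          (Real.sqrt_le_sqrt (doublon_re_le hf hs q)) (Real.sqrt_nonneg _) (Real.sqrt_nonneg _)
    _ = S := Real.mul_self_sqrt hS

/-- **`Q`-BORDER ENTRIES ARE `O(ε)`** at half filling: `‖²Q_{r,(p↑,p↓)}‖ ≤ √S` for every pair index
`r`. [folklore] -/
theorem norm_qMap_apply_holon_le (hf : IsDQGFeasibleSector a b γ Γ) (hN : a + b = Fintype.card Λ)
    (hs : ∑ p : Λ, (Γ (orb p 0, orb p 1) (orb p 0, orb p 1)).re ≤ S) (r : Orb Λ × Orb Λ) (p : Λ) :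
    ‖qMap γ Γ r (orb p 0, orb p 1)‖ ≤ Real.sqrt S :=
  (norm_qMap_apply_le_sqrt_diag hf.dqg r _).trans (Real.sqrt_le_sqrt (holon_re_le hf hN hs p))

/-- The transposed `Q`-border entry `‖²Q_{(p↑,p↓),r}‖ ≤ √S` (`²Q` is Hermitian). [folklore] -/
theorem norm_qMap_holon_apply_le (hf : IsDQGFeasibleSector a b γ Γ) (hN : a + b = Fintype.card Λ)
    (hs : ∑ p : Λ, (Γ (orb p 0, orb p 1) (orb p 0, orb p 1)).re ≤ S) (p : Λ) (r : Orb Λ × Orb Λ) :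
    ‖qMap γ Γ (orb p 0, orb p 1) r‖ ≤ Real.sqrt S := by
  rw [← hf.dqg.q_psd.isHermitian.apply (orb p 0, orb p 1) r, norm_star]
  exact norm_qMap_apply_holon_le hf hN hs r p

/-- **`Q`-CORNER ENTRIES ARE `O(ε²)`** at half filling: `‖²Q_{(p↑,p↓),(q↑,q↓)}‖ ≤ S`. [folklore] -/
theorem norm_qMap_apply_holon_holon_le (hf : IsDQGFeasibleSector a b γ Γ)
    (hN : a + b = Fintype.card Λ)
    (hs : ∑ p : Λ, (Γ (orb p 0, orb p 1) (orb p 0, orb p 1)).re ≤ S) (p q : Λ) :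
    ‖qMap γ Γ (orb p 0, orb p 1) (orb q 0, orb q 1)‖ ≤ S := by
  have hS : 0 ≤ S := by haveI : Nonempty Λ := ⟨p⟩; exact budget_nonneg hf.dqg hs
  refine (norm_qMap_apply_le_sqrt_mul_sqrt hf.dqg _ _).trans ?_
  calc Real.sqrt (qMap γ Γ (orb p 0, orb p 1) (orb p 0, orb p 1)).re *
        Real.sqrt (qMap γ Γ (orb q 0, orb q 1) (orb q 0, orb q 1)).re
      ≤ Real.sqrt S * Real.sqrt S :=
        mul_le_mul (Real.sqrt_le_sqrt (holon_re_le hf hN hs p))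
          (Real.sqrt_le_sqrt (holon_re_le hf hN hs q)) (Real.sqrt_nonneg _) (Real.sqrt_nonneg _)
    _ = S := Real.mul_self_sqrt hS

/-- **THE CHARGE FORM IS `O(ε²)`** at half filling: `Re w_p†Ĝw_p ≤ 2S` (`≤ Re d_p + Re e_p`,
`chargeForm_gHat_re_mem`). [folklore] -/
theorem chargeForm_gHat_re_le (hf : IsDQGFeasibleSector a b γ Γ) (hN : a + b = Fintype.card Λ)
    (hs : ∑ p : Λ, (Γ (orb p 0, orb p 1) (orb p 0, orb p 1)).re ≤ S) (p : Λ) :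
    (star (Pi.single (orb p 0, orb p 0) (1 : ℂ) + Pi.single (orb p 1, orb p 1) 1) ⬝ᵥ
        (gMap γ Γ - vecMulVec (fun r : Orb Λ × Orb Λ => γ r.1 r.2)
          (star fun r : Orb Λ × Orb Λ => γ r.1 r.2)) *ᵥ
          (Pi.single (orb p 0, orb p 0) (1 : ℂ) + Pi.single (orb p 1, orb p 1) 1)).re ≤ 2 * S := by
  linarith [(chargeForm_gHat_re_mem hf.dqg p).2, doublon_re_le hf.dqg hs p, holon_re_le hf hN hs p]

/-- **CONNECTED DENSITY–DENSITY ENTRIES ARE `O(ε²)`** at half filling (the words' `κ_{ii′}`):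
`‖w_p†Ĝw_q‖ ≤ 2S`. [folklore] -/
theorem norm_chargeForm_gHat_le_two_mul (hf : IsDQGFeasibleSector a b γ Γ)
    (hN : a + b = Fintype.card Λ)
    (hs : ∑ p : Λ, (Γ (orb p 0, orb p 1) (orb p 0, orb p 1)).re ≤ S) (p q : Λ) :
    ‖star (Pi.single (orb p 0, orb p 0) (1 : ℂ) + Pi.single (orb p 1, orb p 1) 1) ⬝ᵥ
        (gMap γ Γ - vecMulVec (fun r : Orb Λ × Orb Λ => γ r.1 r.2)
          (star fun r : Orb Λ × Orb Λ => γ r.1 r.2)) *ᵥ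
          (Pi.single (orb q 0, orb q 0) (1 : ℂ) + Pi.single (orb q 1, orb q 1) 1)‖ ≤ 2 * S := by
  have hS : 0 ≤ S := by haveI : Nonempty Λ := ⟨p⟩; exact budget_nonneg hf.dqg hs
  have hp : (Γ (orb p 0, orb p 1) (orb p 0, orb p 1)).re
      + (qMap γ Γ (orb p 0, orb p 1) (orb p 0, orb p 1)).re ≤ 2 * S := by
    linarith [doublon_re_le hf.dqg hs p, holon_re_le hf hN hs p]
  have hq : (Γ (orb q 0, orb q 1) (orb q 0, orb q 1)).re
      + (qMap γ Γ (orb q 0, orb q 1) (orb q 0, orb q 1)).re ≤ 2 * S := by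
    linarith [doublon_re_le hf.dqg hs q, holon_re_le hf hN hs q]
  refine (norm_chargeForm_gHat_le hf.dqg p q).trans ?_
  calc _ ≤ Real.sqrt (2 * S) * Real.sqrt (2 * S) :=
        mul_le_mul (Real.sqrt_le_sqrt hp) (Real.sqrt_le_sqrt hq) (Real.sqrt_nonneg _)
          (Real.sqrt_nonneg _)
    _ = 2 * S := Real.mul_self_sqrt (by linarith)

/-- **LOCAL HALF FILLING UP TO `O(ε)`**: at half filling `(Re n_p − 1)² ≤ 2S` for every site —
every feasible pair whose doublon budget is `O(ε²)` has every site occupation within `O(ε)` of `1`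
(no translation invariance used). [folklore] -/
theorem sq_occupation_sub_one_le_two_mul (hf : IsDQGFeasibleSector a b γ Γ)
    (hN : a + b = Fintype.card Λ)
    (hs : ∑ p : Λ, (Γ (orb p 0, orb p 1) (orb p 0, orb p 1)).re ≤ S) (p : Λ) :
    ((γ (orb p 0) (orb p 0)).re + (γ (orb p 1) (orb p 1)).re - 1) ^ 2 ≤ 2 * S := by
  linarith [sq_occupation_sub_one_le hf.dqg p, doublon_re_le hf.dqg hs p, holon_re_le hf hN hs p]

end Budget

/-! ### §5 With the energy hypothesis: Hubbard-type tables and the TV-H files -/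

section Energy

variable {Λ : Type*} [LinearOrder Λ] [Fintype Λ] {a b : ℕ}
variable {γ : Matrix (Orb Λ) (Orb Λ) ℂ} {Γ : Matrix (Orb Λ × Orb Λ) (Orb Λ × Orb Λ) ℂ}

/-- **HOPS UNDER THE ENERGY HYPOTHESIS.** For every feasible pair of the sector programme of a
half-filled Hubbard-type table (`a + b = |Λ| ≥ 2`, `h_pp = 0`, `‖h_pq‖ ≤ τ`,
`(pq|rs) = U·[p = q = r = s]`, `U > 0`) with `Re E(γ, Γ) ≤ Re E_core`:
`‖γ_{pσ,qσ}‖ ≤ 2 · (4τ|Λ|√|Λ|/U)` for `p ≠ q` — the budget of `StrongCouplingDoublon.sum_doublon_le_sq`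
fed to `norm_hop_le`. [folklore] -/
theorem norm_hop_le_of_energy_le (hf : IsDQGFeasibleSector a b γ Γ) (hN : a + b = Fintype.card Λ)
    (hΛ : 2 ≤ Fintype.card Λ) {h : Λ → Λ → ℂ} {τ : ℝ} (hτ : ∀ p q, ‖h p q‖ ≤ τ)
    (hdiag : ∀ p, h p p = 0) {U : ℝ} (hU : 0 < U) {g : Λ → Λ → Λ → Λ → ℂ}
    (hg : ∀ p q r s, g p q r s = if p = q ∧ q = r ∧ r = s then (U : ℂ) else 0) {hnuc : ℂ}
    (hE : (rdmEnergy h g hnuc γ Γ).re ≤ hnuc.re) {p q : Λ} (hpq : p ≠ q) (σ : Fin 2) :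
    ‖γ (orb p σ) (orb q σ)‖ ≤ 2 * (4 * τ * Fintype.card Λ * Real.sqrt (Fintype.card Λ) / U) := by
  have hτ0 : 0 ≤ τ := le_trans (norm_nonneg _) (hτ p p)
  have hC : 0 ≤ 4 * τ * Fintype.card Λ * Real.sqrt (Fintype.card Λ) / U := by positivity
  have h := norm_hop_le hf hN hΛ
    (StrongCouplingDoublon.sum_doublon_le_sq hf hN hΛ hτ hdiag hU hg hE) hpq σ
  rwa [Real.sqrt_sq hC] at h

/-- **LOCAL HALF FILLING UNDER THE ENERGY HYPOTHESIS**: under the same hypotheses every site has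
`(Re n_p − 1)² ≤ 2 (4τ|Λ|√|Λ|/U)²`. [folklore] -/
theorem sq_occupation_sub_one_le_of_energy_le (hf : IsDQGFeasibleSector a b γ Γ)
    (hN : a + b = Fintype.card Λ) (hΛ : 2 ≤ Fintype.card Λ) {h : Λ → Λ → ℂ} {τ : ℝ}
    (hτ : ∀ p q, ‖h p q‖ ≤ τ) (hdiag : ∀ p, h p p = 0) {U : ℝ} (hU : 0 < U)
    {g : Λ → Λ → Λ → Λ → ℂ}
    (hg : ∀ p q r s, g p q r s = if p = q ∧ q = r ∧ r = s then (U : ℂ) else 0) {hnuc : ℂ}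
    (hE : (rdmEnergy h g hnuc γ Γ).re ≤ hnuc.re) (p : Λ) :
    ((γ (orb p 0) (orb p 0)).re + (γ (orb p 1) (orb p 1)).re - 1) ^ 2
      ≤ 2 * (4 * τ * Fintype.card Λ * Real.sqrt (Fintype.card Λ) / U) ^ 2 :=
  sq_occupation_sub_one_le_two_mul hf hN
    (StrongCouplingDoublon.sum_doublon_le_sq hf hN hΛ hτ hdiag hU hg hE) p

end Energy

section TVH

open Summit.Ventures.CertifiedQuantumChemistry.Hamiltonians

/-- **CLAIM N STEP (1), THE WHOLE LIST, FOR THE TV-H FILES — UNCONDITIONALLY AT THE OPTIMUM.** For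
`hubbardRingTV L t U` at half filling `a + b = L ≥ 2`, `U > 0`, an OPTIMAL feasible pair of the
`D, Q, G` sector programme exists (its energy IS the value; the value is `≤ 0`,
`hubbardRingTV_pqgSectorEnergy_le_zero`) and, with `C := 4|t|L√L/U` (`S = C² = 16t²L³/U²`), it obeys:
every doublon and holon weight `≤ C²` and every site occupation within `(Re n_p − 1)² ≤ 2C²` of one;
every hop `‖γ_{pσ,qσ}‖ ≤ 2C` (`p ≠ q`); every `D`- and `Q`-entry against a doubly occupied pair index
`≤ C` (all pair indices `r`); every doublon–doublon / holon–holon entry `≤ C²` and every connected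
density–density moment `‖w_p†Ĝw_q‖ ≤ 2C²` — i.e. along `U → ∞` every entry class of CLAIM N (1) is
`O(1/U)` resp. `O(1/U²)` on the cell's files, kernel-checked. [folklore] -/
theorem hubbardRingTV_optimal_entry_bounds {L : ℕ} (hL : 2 ≤ L) (t : ℚ) {U : ℚ} (hU : 0 < U)
    {a b : ℕ} (hN : a + b = L) :
    ∃ (γ : Matrix (Orb (Fin L)) (Orb (Fin L)) ℂ)
      (Γ : Matrix (Orb (Fin L) × Orb (Fin L)) (Orb (Fin L) × Orb (Fin L)) ℂ),
      IsDQGFeasibleSector a b γ Γ ∧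
      (rdmEnergy (fun p q => ((hubbardRingTV L t U).h p q : ℂ))
          (fun p q r s => ((hubbardRingTV L t U).eri p q r s : ℂ))
          ((hubbardRingTV L t U).ecore : ℂ) γ Γ).re
        = pqgSectorEnergy (fun p q => ((hubbardRingTV L t U).h p q : ℂ))
          (fun p q r s => ((hubbardRingTV L t U).eri p q r s : ℂ))
          ((hubbardRingTV L t U).ecore : ℂ) a b ∧
      (∀ p : Fin L,
        (Γ (orb p 0, orb p 1) (orb p 0, orb p 1)).re ≤ (4 * |(t : ℝ)| * L * Real.sqrt L / U) ^ 2 ∧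
        (qMap γ Γ (orb p 0, orb p 1) (orb p 0, orb p 1)).re ≤ (4 * |(t : ℝ)| * L * Real.sqrt L / U) ^ 2 ∧
        ((γ (orb p 0) (orb p 0)).re + (γ (orb p 1) (orb p 1)).re - 1) ^ 2
          ≤ 2 * (4 * |(t : ℝ)| * L * Real.sqrt L / U) ^ 2) ∧
      (∀ p q : Fin L, p ≠ q → ∀ σ : Fin 2,
        ‖γ (orb p σ) (orb q σ)‖ ≤ 2 * (4 * |(t : ℝ)| * L * Real.sqrt L / U)) ∧
      (∀ (r : Orb (Fin L) × Orb (Fin L)) (p : Fin L),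
        ‖Γ r (orb p 0, orb p 1)‖ ≤ 4 * |(t : ℝ)| * L * Real.sqrt L / U ∧
        ‖qMap γ Γ r (orb p 0, orb p 1)‖ ≤ 4 * |(t : ℝ)| * L * Real.sqrt L / U) ∧
      (∀ p q : Fin L,
        ‖Γ (orb p 0, orb p 1) (orb q 0, orb q 1)‖ ≤ (4 * |(t : ℝ)| * L * Real.sqrt L / U) ^ 2 ∧
        ‖qMap γ Γ (orb p 0, orb p 1) (orb q 0, orb q 1)‖ ≤ (4 * |(t : ℝ)| * L * Real.sqrt L / U) ^ 2 ∧
        ‖star (Pi.single (orb p 0, orb p 0) (1 : ℂ) + Pi.single (orb p 1, orb p 1) 1) ⬝ᵥ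
            (gMap γ Γ - vecMulVec (fun r : Orb (Fin L) × Orb (Fin L) => γ r.1 r.2)
              (star fun r : Orb (Fin L) × Orb (Fin L) => γ r.1 r.2)) *ᵥ
            (Pi.single (orb q 0, orb q 0) (1 : ℂ) + Pi.single (orb q 1, orb q 1) 1)‖
          ≤ 2 * (4 * |(t : ℝ)| * L * Real.sqrt L / U) ^ 2) := by
  obtain ⟨γ, Γ, hf, hE, hs⟩ :=
    StrongCouplingDoublon.hubbardRingTV_optimal_sum_doublon_le_sq hL t hU hN
  have hcard : a + b = Fintype.card (Fin L) := by rw [Fintype.card_fin]; exact hN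
  have hΛ : 2 ≤ Fintype.card (Fin L) := by rw [Fintype.card_fin]; exact hL
  have hU' : (0 : ℝ) < (U : ℝ) := by exact_mod_cast hU
  have hC : 0 ≤ 4 * |(t : ℝ)| * L * Real.sqrt L / U := by positivity
  have hsq : Real.sqrt ((4 * |(t : ℝ)| * L * Real.sqrt L / U) ^ 2)
      = 4 * |(t : ℝ)| * L * Real.sqrt L / U := Real.sqrt_sq hC
  refine ⟨γ, Γ, hf, hE, fun p => ⟨doublon_re_le hf.dqg hs p, holon_re_le hf hcard hs p,
    sq_occupation_sub_one_le_two_mul hf hcard hs p⟩, fun p q hpq σ => ?_, fun r p => ⟨?_, ?_⟩,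
    fun p q => ⟨norm_two_apply_doublon_doublon_le hf.dqg hs p q,
      norm_qMap_apply_holon_holon_le hf hcard hs p q,
      norm_chargeForm_gHat_le_two_mul hf hcard hs p q⟩⟩
  · have h := norm_hop_le hf hcard hΛ hs hpq σ
    rwa [hsq] at h
  · have h := norm_two_apply_doublon_le hf.dqg hs r p
    rwa [hsq] at h
  · have h := norm_qMap_apply_holon_le hf hcard hs r p
    rwa [hsq] at h

end TVH

end StrongCouplingEntry

end Summit.Ventures.CertifiedQuantumChemistry
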